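import Literature.AlgebraicGeometry.ComplexMultiplication.CyclotomicFermatCMTypesTwoPrimeLevelSimple
import HarnessLib

/-!
# Koblitz–Rohrlich's Proposition at the two-prime levels DIVISIBLE BY `3`, `N = 3ᵃqᵇ ∉ {21, 39}` (§2 Remark 2, "it can similarly be proved"),
# and THEOREMS 1 (i)–(ii), 2 in the relatively prime case UNCONDITIONALLY at every ODD two-prime level `N ∉ {21, 39}`

Layer `Literature/AlgebraicGeometry/ComplexMultiplication`, namespace `…ComplexMultiplication.CyclotomicFermatCMType`; sequel of
`CyclotomicFermatCMTypesTwoPrimeLevelSimple` (K–R's "Case 1. `m = 2`": `12·(A(p; qᵇ) + A(q; pᵃ)) < φ(pᵃ)φ(qᵇ)` for distinct primes `p, q ≥ 5`,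
and Theorems 1–2 at `N = pᵃqᵇ`), with the side counts `A(m; M) = #{ψ mod M odd : ψ(m) = 1}` of `CyclotomicFermatCMTypesBadOddCharacterCount`.
THEOREMS ONLY (no definition, no named fact, no `sorry`).

THE SOURCE.  N. Koblitz, D. Rohrlich, *Simple factors in the Jacobian of a Fermat curve*, Canad. J. Math. **30** (1978) 1183–1205, §2
(pp. 1187–1193).  The PROPOSITION (p. 1190) "Suppose `2, 3 ∤ N`. … Then `#S₀(N) < (1/6)#S(N)`" is stated for `N` prime to `6`, but the §2
argument for THEOREM 1 ("(i) `H_{r,s,t} = H_{r′,s′,t′}` if and only if `{r, s, t} ∼ {r′, s′, t′}`. (ii) The only isogenies between the lattices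
`L_{r,s,t}` are the obvious equalities.", p. 1185) in the relatively prime case needs only `N` odd and `#S₀(N) < #S(N)/6` (tree:
`CyclotomicFermatCMTypesOddLevelSimple`), and REMARK 2 (p. 1193) records what happens when `3 ∣ N`: "If `N` is odd and `3|N`, it can similarly be
proved that there are precisely two values of `N` for which `s(N) ≥ 1/6`: `s(21) = 1/6`, `s(39) = 1/4`.  For all other values of `N`, it thus
follows that there can be no non-obvious isogenies between `J_{r,s,t}` and `J_{r′,s′,t′}` if `r, s, t, r′, s′, t′` are all prime to `N`."  No proof
is printed.  THIS FILE PROVES THE CLAIM AT THE TWO-PRIME LEVELS `N = 3ᵃqᵇ` (`q ≥ 5` prime, `a, b ≥ 1`): `12·#S₀(N) < φ(N)` iff `N ∉ {21, 39}`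
— more precisely the forward half here (`N ∉ {21, 39} ⟹ 12·(A(3; qᵇ) + A(q; 3ᵃ)) < φ(3ᵃ)φ(qᵇ) ⟹ 12·#S₀(N) < φ(N)`; the two failures
`12·#S₀(21) = φ(21)`, `12·#S₀(39) > φ(39)` are the sibling `CyclotomicFermatCMTypesBadOddCharacterCountExact`'s `s(21) = 1/6`, `s(39) = 1/4`) —
and assembles, with `CyclotomicFermatCMTypesTwoPrimeLevelSimple`, THE PROPOSITION AND THEOREMS 1 (i)–(ii), 2 (RELATIVELY PRIME CASE) AT EVERY ODD
TWO-PRIME LEVEL `N = pᵃqᵇ ∉ {21, 39}`.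

THE ARITHMETIC (ours; K–R print none for `3 ∣ N`).  Write `A = A(3; qᵇ)`, `B = A(q; 3ᵃ)`, `Φ₁ = φ(3ᵃ) = 2t` (`t = 3ᵃ⁻¹`), `Φ₂ = φ(qᵇ)`.
Always `2B ≤ Φ₁`, and `B = 0` if `q ≡ 2 (mod 3)` (`q ≡ −1`); `A = 0` or the order `d` of `3` modulo `qᵇ` is odd with `2dA = Φ₂`, where `d ≠ 1`
(`3 ≢ 1`) and `d = 3` forces `qᵇ ∣ 26`, i.e. `q = 13`, `b = 1`.  Cases: `q = 5` — `A = B = 0` (`3² ≡ −1 (5)`, `5 ≡ −1 (3)`); `q = 7` — `A = 0`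
(`3³ ≡ −1 (7)`), and `B = 0` or `2eB = 2t` with `e` = the order of `7` modulo `3ᵃ`, `e ≥ 3` once `a ≥ 2` (`7 ≢ 1 (9)`): `12B ≤ 4t < 12t ≤ Φ₁Φ₂`
for `a ≥ 2`, and `12B ≤ 12 < 84 ≤ Φ₁Φ₂` for `a = 1`, `b ≥ 2` (`a = b = 1` is `N = 21`); `q = 13` — `b = 1`: `A ≤ 2`, and `a ≥ 2` (`a = 1` is `N = 39`)
gives `3B ≤ t` (`13 ≢ 1 (9)`), so `12(A + B) ≤ 24 + 4t < 24t`; `b ≥ 2`: `d ≥ 5`, `10A ≤ Φ₂ ≥ 156`, `2B ≤ 2t`; otherwise (`q = 11` or `q ≥ 17`) —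
`d ≥ 5` so `10A ≤ Φ₂`, `B ≤ t`, `B = 0` unless `q ≡ 1 (3)` (then `q ≥ 19`, `Φ₂ ≥ 18`): `a = 1`: `12A + 12B ≤ (6/5)Φ₂ + 12 < 2Φ₂`; `a ≥ 2`:
`(6/5)Φ₂ + 6Φ₁ < Φ₁Φ₂`.

## What is proved

* §1 units: the order of `m` modulo `M` is `1` iff `m ≡ 1`; `(m)^{ord} = 1` read as `M ∣ mᵈ − 1`; reduction `ZMod 3ᵃ → ZMod 9` (order `≠ 1` when
  `m ≢ 1 (mod 9)`, `a ≥ 2`); odd orders `∉ {1}` are `≥ 3`, `∉ {1, 3}` are `≥ 5` — private.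
* §2 **`twelve_mul_card_sides_lt_three`**: `q ≥ 5` prime, `a, b ≥ 1`, `3ᵃqᵇ ∉ {21, 39}` ⟹ `12·(A(3; qᵇ) + A(q; 3ᵃ)) < φ(3ᵃ)·φ(qᵇ)`.
* §3 **THE PROPOSITION AT `N = 3ᵃqᵇ ∉ {21, 39}`**: `twelve_mul_sum_card_lt_totient_three`, `twelve_mul_card_bad_lt_totient_three`
  (`12·#S₀(N) < φ(N)`), `exists_goodFinset_three`; and **AT EVERY ODD TWO-PRIME LEVEL `N = pᵃqᵇ ∉ {21, 39}`** (`p ≠ q` odd primes):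
  `twelve_mul_card_bad_lt_totient_oddTwoPrimes`, `exists_goodFinset_oddTwoPrimes`.
* §4 **THEOREMS 1 (i)–(ii) AND 2, RELATIVELY PRIME CASE, UNCONDITIONALLY AT EVERY ODD TWO-PRIME LEVEL `N ∉ {21, 39}`**:
  `forall_mem_fermatCMType_iff_iff_multiset_eq_oddTwoPrimes` (`H_{r′,s′,t′} = h⁻¹H_{r,s,t} ⟺ {r′,s′,t′} = {hr,hs,ht}`), (∗)
  `fermatCMType_eq_iff_multiset_eq_oddTwoPrimes`, the stabiliser `forall_mem_fermatCMType_one_iff_mul_mem_iff_oddTwoPrimes`,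
  `isPrimitive_fermat_one_iff_oddTwoPrimes` / `isSimple_of_fermat_one_iff_oddTwoPrimes`, `isIsogenous_fermatCMType_iff_exists_multiset_eq_oddTwoPrimes`
  ("no non-obvious isogenies … if `r, s, t, r′, s′, t′` are all prime to `N`"), non-vacuity `exists_isSimple_of_fermat_one_oddTwoPrimes`.

## Honest column / NOT here

* K–R's Remark 2 is a claim about ALL odd `N` with `3 ∣ N`; this file settles the two-prime levels `3ᵃqᵇ` only (numerically the structural bound
  `12·Σ_p A(p; N_p) < φ(N)` holds at every odd `N < 60000` with `3 ∣ N` other than `21, 39` — checked this session, not typed); levels `3ᵃ∏qᵢ^{bᵢ}`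
  with two or more primes `qᵢ ≥ 5` are NOT typed, so Theorems 1–2 stay conditional there (`…OddLevelSimple`).
* At `N = 21` and `N = 39` nothing is asserted here: the hypothesis fails (sibling `…BadOddCharacterCountExact`:
  `not_twelve_mul_card_bad_lt_totient_twentyOne/thirtyNine`); whether (∗) itself holds there for unit triples is a finite check not made here
  (K–R's "non-obvious isogenies" at `21`, `39` are with factors of lower level, p. 1193).
* The case analysis above is ours (K–R: "it can similarly be proved"); `[cite]` tags point to Remark 2 for the STATEMENT and to the Proposition's
  proof for the METHOD.  Relatively prime case only; as in the siblings the statements are about `H_{r,s,t}`, the CM types `Φ_{H_{r,s,t}}` of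
  `ℚ(ζ_N)` and all abelian varieties of those types.
* Private: §1, `three_facts`, `prime_cases_q`, `level_hyps₃`, `twelve_mul_sum_card_lt_totient_of_sides`.

## References

* [KoblitzRohrlich1978] N. Koblitz, D. Rohrlich, Canad. J. Math. 30 (1978) 1183–1205: Theorems 1–2 (pp. 1185–1186), §2 Proposition and proof
  (pp. 1190–1191), Remark 2 (p. 1193).
* [Shimura1998] G. Shimura, *Abelian Varieties with Complex Multiplication and Modular Functions*, §6.1–6.2, §8.2 Prop. 26, §8.4 Example (1)
  (through the siblings).
* [Washington1997] L. C. Washington, *Introduction to Cyclotomic Fields*, Cor. 4.4 (through the siblings).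

## Provenance

Cell `pub-hodgecm2` (COR-CM), literature seat `lit-deligne-3` gen 35 (claim KR78-THREELEVEL; count-neutral, own lane).
-/

noncomputable section

open NumberField

namespace Literature.AlgebraicGeometry.ComplexMultiplication

open Literature.NumberTheory.ComplexMultiplication
open Literature.NumberTheory.LFunctions

namespace CyclotomicFermatCMType

/-! ## §1 Units: orders `= 1`, `= 3`, and the reduction `ℤ/3ᵃ → ℤ/9` -/

section Units

variable {M : ℕ}

/-- The order of `m` modulo `M` is `1` iff `m ≡ 1 (mod M)` (private copy of the sibling's). [folklore] -/
private theorem orderOf_unitOfCoprime_eq_one_iff' {m : ℕ} (hm : m.Coprime M) :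
    orderOf (ZMod.unitOfCoprime m hm) = 1 ↔ (m : ZMod M) = 1 := by
  rw [orderOf_eq_one_iff, ← ZMod.coe_unitOfCoprime m hm]
  exact ⟨fun h => by rw [h, Units.val_one], fun h => Units.ext (h.trans Units.val_one.symm)⟩

/-- `M ∣ mᵈ − 1` for `d` the order of `m` modulo `M` (`m ≥ 1`). [folklore] -/
private theorem dvd_pow_orderOf_sub_one' {m : ℕ} (hm : m.Coprime M) (hm1 : 1 ≤ m) :
    M ∣ m ^ orderOf (ZMod.unitOfCoprime m hm) - 1 := by
  have hu : ((m : ZMod M)) ^ orderOf (ZMod.unitOfCoprime m hm) = 1 := by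
    rw [← ZMod.coe_unitOfCoprime m hm, ← Units.val_pow_eq_pow_val, pow_orderOf_eq_one, Units.val_one]
  have h1 : 1 ≤ m ^ orderOf (ZMod.unitOfCoprime m hm) := Nat.one_le_pow _ _ hm1
  have h : ((m ^ orderOf (ZMod.unitOfCoprime m hm) - 1 : ℕ) : ZMod M) = 0 := by
    rw [Nat.cast_sub h1, Nat.cast_pow, Nat.cast_one, hu, sub_self]
  exact (ZMod.natCast_eq_zero_iff _ _).1 h

/-- **Reduction modulo `9`**: if `m ≢ 1 (mod 9)` then the order of `m` modulo `3ᵃ` (`a ≥ 2`) is not `1`. [folklore] -/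
private theorem orderOf_ne_one_of_mod_nine {a m : ℕ} (ha : 2 ≤ a) (hm : m.Coprime (3 ^ a)) (h9 : ((m : ZMod 9)) ≠ 1) :
    orderOf (ZMod.unitOfCoprime m hm) ≠ 1 := by
  rw [Ne, orderOf_unitOfCoprime_eq_one_iff' hm]
  intro h1
  have h9dvd : 9 ∣ 3 ^ a := by
    rw [show (9 : ℕ) = 3 ^ 2 by norm_num]
    exact Nat.pow_dvd_pow 3 ha
  have h := congrArg (ZMod.castHom h9dvd (ZMod 9)) h1
  rw [map_natCast, map_one] at h
  exact h9 h

/-- An odd natural number other than `1` is `≥ 3`; other than `1` and `3` it is `≥ 5`. [folklore] -/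
private theorem five_le_of_odd {d : ℕ} (hodd : Odd d) (h1 : d ≠ 1) (h3 : d ≠ 3) : 5 ≤ d := by
  obtain ⟨k, hk⟩ := hodd
  omega

/-- An odd natural number other than `1` is `≥ 3`. [folklore] -/
private theorem three_le_of_odd {d : ℕ} (hodd : Odd d) (h1 : d ≠ 1) : 3 ≤ d := by
  obtain ⟨k, hk⟩ := hodd
  omega

end Units

/-! ## §2 The arithmetic at `N = 3ᵃqᵇ`: `12·(A(3; qᵇ) + A(q; 3ᵃ)) < φ(3ᵃ)φ(qᵇ)` unless `N ∈ {21, 39}` -/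

section ThreeLevel

/-- Kernel facts: `3² ≡ −1 (mod 5)`, `3³ ≡ −1 (mod 7)`, `7 ≢ 1 (mod 9)`, `13 ≢ 1 (mod 9)`, `2 ≡ −1 (mod 3)`. [folklore] -/
private theorem three_facts :
    ((3 : ℕ) : ZMod 5) ^ 2 = -1 ∧ ((3 : ℕ) : ZMod 7) ^ 3 = -1 ∧ ((7 : ℕ) : ZMod 9) ≠ 1 ∧ ((13 : ℕ) : ZMod 9) ≠ 1 ∧
      ((2 : ℕ) : ZMod 3) = -1 := by
  decide

/-- The primes `q ≥ 5`: `q = 5`, `7`, `11`, `13`, or `q ≥ 17`. [folklore] -/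
private theorem prime_cases_q {q : ℕ} (hq : q.Prime) (h5 : 5 ≤ q) : q = 5 ∨ q = 7 ∨ q = 11 ∨ q = 13 ∨ 17 ≤ q := by
  by_cases h17 : 17 ≤ q
  · exact Or.inr (Or.inr (Or.inr (Or.inr h17)))
  · interval_cases q
    all_goals first
      | exact Or.inl rfl
      | exact Or.inr (Or.inl rfl)
      | exact Or.inr (Or.inr (Or.inl rfl))
      | exact Or.inr (Or.inr (Or.inr (Or.inl rfl)))
      | exact absurd hq (by decide)

/-- A prime `q ≥ 5` with `q ≡ 1 (mod 3)` other than `7` and `13` is `≥ 19`. [folklore] -/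
private theorem nineteen_le_of_mod_three {q : ℕ} (hq : q.Prime) (h5 : 5 ≤ q) (h1 : q % 3 = 1) (h7 : q ≠ 7) (h13 : q ≠ 13) :
    19 ≤ q := by
  by_contra h
  rw [not_le] at h
  interval_cases q
  all_goals first
    | omega
    | exact absurd hq (by decide)

/-- **`B = A(q; 3ᵃ) = 0` when `q ≡ 2 (mod 3)`** (`q ≡ −1` is "a root of `−1`" modulo `3ᵃ`). [cite: KoblitzRohrlich1978, §2 proof of the Proposition (p. 1190)] -/
theorem card_side_three_pow_eq_zero_of_mod_three {q a : ℕ} (ha : a ≠ 0) (hq : q.Coprime (3 ^ a)) (h2 : q % 3 = 2) :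
    Nat.card {ψ : DirichletCharacter ℂ (3 ^ a) // ψ.Odd ∧ ψ (q : ZMod (3 ^ a)) = 1} = 0 := by
  refine card_side_eq_zero_of_pow_natCast_eq_neg_one (q := 3) (by decide) ha hq (j := 1) ?_
  rw [pow_one, ← ZMod.natCast_mod, h2]
  exact three_facts.2.2.2.2

/-- **If the order of `3` modulo `qᵇ` is `3` then `qᵇ ∣ 26`, so `q = 13` and `b = 1`** (`q ≥ 5` prime). [folklore] -/
private theorem eq_thirteen_of_orderOf_eq_three {q b : ℕ} (hq : q.Prime) (hq5 : 5 ≤ q) (hb : b ≠ 0) (h3 : (3 : ℕ).Coprime (q ^ b))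
    (hd : orderOf (ZMod.unitOfCoprime 3 h3) = 3) : q = 13 ∧ b = 1 := by
  have hdvd : q ^ b ∣ 26 := by
    have h := dvd_pow_orderOf_sub_one' h3 (by norm_num)
    rw [hd] at h
    norm_num at h
    exact h
  have hq13 : q = 13 := by
    have hqd : q ∣ 2 * 13 := dvd_trans (dvd_pow_self q hb) hdvd
    rcases (Nat.Prime.dvd_mul hq).1 hqd with h2 | h13
    · exfalso
      have := Nat.le_of_dvd (by norm_num) h2
      omega
    · exact (Nat.prime_dvd_prime_iff_eq hq (by norm_num)).1 h13
  subst hq13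
  refine ⟨rfl, ?_⟩
  by_contra hb1
  have hb2 : 2 ≤ b := by omega
  have h169 : 13 ^ 2 ∣ 26 := dvd_trans (Nat.pow_dvd_pow 13 hb2) hdvd
  norm_num at h169

/-- **THE ARITHMETIC AT `N = 3ᵃqᵇ`** (Koblitz–Rohrlich's Remark 2 at two-prime levels, our case analysis in the style of their "Case 1. `m = 2`"):
for a prime `q ≥ 5`, `a, b ≥ 1` and `3ᵃqᵇ ∉ {21, 39}`: `12·(#{ψ mod qᵇ odd : ψ(3) = 1} + #{ψ mod 3ᵃ odd : ψ(q) = 1}) < φ(3ᵃ)·φ(qᵇ)`.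
[cite: KoblitzRohrlich1978, §2 Remark 2 (p. 1193) and proof of the Proposition, Case 1 (pp. 1190–1191)] -/
theorem twelve_mul_card_sides_lt_three {q a b : ℕ} [hq : Fact q.Prime] (hq5 : 5 ≤ q) (ha : a ≠ 0) (hb : b ≠ 0)
    (h21 : 3 ^ a * q ^ b ≠ 21) (h39 : 3 ^ a * q ^ b ≠ 39) :
    12 * (Nat.card {ψ : DirichletCharacter ℂ (q ^ b) // ψ.Odd ∧ ψ ((3 : ℕ) : ZMod (q ^ b)) = 1} +
        Nat.card {ψ : DirichletCharacter ℂ (3 ^ a) // ψ.Odd ∧ ψ (q : ZMod (3 ^ a)) = 1}) <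
      (3 ^ a).totient * (q ^ b).totient := by
  haveI : NeZero (q ^ b) := ⟨pow_ne_zero b hq.out.ne_zero⟩
  haveI : NeZero (3 ^ a) := ⟨pow_ne_zero a three_ne_zero⟩
  have hq2 : q ≠ 2 := by omega
  have hq3 : q ≠ 3 := by omega
  have copr1 : (3 : ℕ).Coprime (q ^ b) := ((Nat.coprime_primes Nat.prime_three hq.out).2 hq3.symm).pow_right b
  have copr2 : q.Coprime (3 ^ a) := ((Nat.coprime_primes hq.out Nat.prime_three).2 hq3).pow_right a
  -- the totients: `Φ₁ = 2t`, `t = 3^{a-1}`; `Φ₂ = q^{b-1}(q-1)`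
  set A := Nat.card {ψ : DirichletCharacter ℂ (q ^ b) // ψ.Odd ∧ ψ ((3 : ℕ) : ZMod (q ^ b)) = 1} with hA
  set B := Nat.card {ψ : DirichletCharacter ℂ (3 ^ a) // ψ.Odd ∧ ψ (q : ZMod (3 ^ a)) = 1} with hB
  set t := 3 ^ (a - 1) with ht
  have ht1 : 1 ≤ t := Nat.one_le_pow _ _ (by norm_num)
  have hΦ₁ : (3 ^ a).totient = 2 * t := by
    rw [Nat.totient_prime_pow Nat.prime_three (Nat.pos_of_ne_zero ha), ht]
    ring
  have hΦ₂ : (q ^ b).totient = q ^ (b - 1) * (q - 1) := Nat.totient_prime_pow hq.out (Nat.pos_of_ne_zero hb)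
  have hqb : 1 ≤ q ^ (b - 1) := Nat.one_le_pow _ _ hq.out.pos
  have hΦ₂ge : q - 1 ≤ (q ^ b).totient := by
    rw [hΦ₂]
    calc q - 1 = 1 * (q - 1) := (one_mul _).symm
      _ ≤ q ^ (b - 1) * (q - 1) := Nat.mul_le_mul_right _ hqb
  have hΦ₂ge' : 2 ≤ b → q * (q - 1) ≤ (q ^ b).totient := fun hb2 => by
    rw [hΦ₂]
    refine Nat.mul_le_mul_right _ ?_
    calc q = q ^ 1 := (pow_one q).symm
      _ ≤ q ^ (b - 1) := Nat.pow_le_pow_right hq.out.pos (by omega)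
  -- `2B ≤ Φ₁ = 2t`
  have hB2 : 2 * B ≤ 2 * t := hΦ₁ ▸ two_mul_card_side_le (q := 3) (by decide) ha copr2
  have hBt : B ≤ t := by omega
  -- `t = 1` iff `a = 1`; `a ≥ 2 ⟹ 3 ≤ t`
  have ht3 : 2 ≤ a → 3 ≤ t := fun ha2 => by
    rw [ht]
    calc 3 = 3 ^ 1 := (pow_one 3).symm
      _ ≤ 3 ^ (a - 1) := Nat.pow_le_pow_right (by norm_num) (by omega)
  -- the `B`-dichotomy at modulus `3ᵃ` with `e` = order of `q`: `B = 0` or (`e` odd, `2eB = 2t`); for `a ≥ 2` and `q ≢ 1 (9)`: `3B ≤ t`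
  have hB3 : 2 ≤ a → ((q : ZMod 9)) ≠ 1 → 3 * B ≤ t := fun ha2 h9 => by
    rcases card_side_dichotomy (q := 3) (by decide) ha copr2 with h0 | ⟨hodd, he⟩
    · rw [← hB] at h0
      rw [h0, mul_zero]
      exact Nat.zero_le _
    · rw [← hB, hΦ₁] at he
      have he1 := orderOf_ne_one_of_mod_nine ha2 copr2 h9
      have he3 := three_le_of_odd hodd he1
      have : 2 * 3 * B ≤ 2 * t := by
        rw [← he]
        exact Nat.mul_le_mul_right _ (Nat.mul_le_mul_left 2 he3)
      omega
  rw [hΦ₁]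
  -- case analysis on `q`
  rcases prime_cases_q hq.out hq5 with rfl | rfl | hq11 | rfl | hq17
  · -- `q = 5`: `A = 0` (`3² ≡ −1 (5)`), `B = 0` (`5 ≡ 2 (3)`)
    have hA0 : A = 0 := card_side_eq_zero_of_pow_natCast_eq_neg_one hq2 hb copr1 three_facts.1
    have hB0 : B = 0 := card_side_three_pow_eq_zero_of_mod_three ha copr2 (by norm_num)
    rw [hA0, hB0]
    exact Nat.mul_pos (by omega) (Nat.totient_pos.2 (NeZero.pos _))
  · -- `q = 7`: `A = 0` (`3³ ≡ −1 (7)`)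
    have hA0 : A = 0 := card_side_eq_zero_of_pow_natCast_eq_neg_one hq2 hb copr1 three_facts.2.1
    rw [hA0, zero_add]
    by_cases ha1 : a = 1
    · -- `a = 1`: `b ≥ 2` (`N ≠ 21`), `B ≤ 1`, `Φ₂ ≥ 42`
      subst ha1
      have hb2 : 2 ≤ b := by
        by_contra h
        have hb1 : b = 1 := by omega
        subst hb1
        exact h21 (by norm_num)
      have h42 := hΦ₂ge' hb2
      have ht1' : t = 1 := by rw [ht]; norm_num
      rw [ht1'] at hBt ⊢
      omega
    · -- `a ≥ 2`: `3B ≤ t` (`7 ≢ 1 (9)`), so `12B ≤ 4t < 12t ≤ 2t·Φ₂`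
      have ha2 : 2 ≤ a := by omega
      have h3B := hB3 ha2 three_facts.2.2.1
      have h6 : 6 ≤ (7 ^ b).totient := le_trans (by norm_num) hΦ₂ge
      nlinarith
  · -- `q = 11`: generic (`d ≥ 5`, `B = 0`)
    subst hq11
    have hB0 : B = 0 := card_side_three_pow_eq_zero_of_mod_three ha copr2 (by norm_num)
    rw [hB0, add_zero]
    have h10 : 10 ≤ (11 ^ b).totient := le_trans (by norm_num) hΦ₂ge
    rcases card_side_dichotomy hq2 hb copr1 with hA0 | ⟨hodd, hdA⟩
    · rw [← hA] at hA0
      rw [hA0]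
      nlinarith
    · rw [← hA] at hdA
      have hd1 : orderOf (ZMod.unitOfCoprime 3 copr1) ≠ 1 := by
        rw [Ne, orderOf_unitOfCoprime_eq_one_iff' copr1]
        intro h1
        have h := (ZMod.natCast_eq_natCast_iff' 3 1 (11 ^ b)).1 (by rw [Nat.cast_one]; exact h1)
        have hlt : 3 < 11 ^ b := lt_of_lt_of_le (by norm_num : 3 < 11) (by
          calc 11 = 11 ^ 1 := (pow_one 11).symm
            _ ≤ 11 ^ b := Nat.pow_le_pow_right (by norm_num) (Nat.one_le_iff_ne_zero.2 hb))
        rw [Nat.mod_eq_of_lt hlt, Nat.mod_eq_of_lt (lt_trans (by norm_num) hlt)] at h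
        omega
      have hd3 : orderOf (ZMod.unitOfCoprime 3 copr1) ≠ 3 := fun h3 =>
        absurd (eq_thirteen_of_orderOf_eq_three hq.out hq5 hb copr1 h3).1 (by norm_num)
      have hd5 := five_le_of_odd hodd hd1 hd3
      have h10A : 10 * A ≤ (11 ^ b).totient := by
        rw [← hdA]
        calc 10 * A = 2 * 5 * A := by ring
          _ ≤ 2 * orderOf (ZMod.unitOfCoprime 3 copr1) * A := Nat.mul_le_mul_right _ (Nat.mul_le_mul_left 2 hd5)
      nlinarith
  · -- `q = 13`
    rcases card_side_dichotomy hq2 hb copr1 with hA0 | ⟨hodd, hdA⟩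
    · -- `A = 0`: `12B ≤ 12t < 2t·Φ₂`
      rw [← hA] at hA0
      rw [hA0, zero_add]
      have h12 : 12 ≤ (13 ^ b).totient := le_trans (by norm_num) hΦ₂ge
      nlinarith
    · rw [← hA] at hdA
      have hd1 : orderOf (ZMod.unitOfCoprime 3 copr1) ≠ 1 := by
        rw [Ne, orderOf_unitOfCoprime_eq_one_iff' copr1]
        intro h1
        have h := (ZMod.natCast_eq_natCast_iff' 3 1 (13 ^ b)).1 (by rw [Nat.cast_one]; exact h1)
        have hlt : 3 < 13 ^ b := lt_of_lt_of_le (by norm_num : 3 < 13) (by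
          calc 13 = 13 ^ 1 := (pow_one 13).symm
            _ ≤ 13 ^ b := Nat.pow_le_pow_right (by norm_num) (Nat.one_le_iff_ne_zero.2 hb))
        rw [Nat.mod_eq_of_lt hlt, Nat.mod_eq_of_lt (lt_trans (by norm_num) hlt)] at h
        omega
      by_cases hb1 : b = 1
      · -- `b = 1`: `Φ₂ = 12`, `A ≤ 2`; `a ≥ 2` (`N ≠ 39`), `3B ≤ t`: `12(A + B) ≤ 24 + 4t < 24t`
        subst hb1
        have ha2 : 2 ≤ a := by
          by_contra h
          have ha1 : a = 1 := by omega
          subst ha1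
          exact h39 (by norm_num)
        have h3B := hB3 ha2 three_facts.2.2.2.1
        have ht3' := ht3 ha2
        have hΦ₂' : (13 ^ 1).totient = 12 := by norm_num [Nat.totient_prime]
        rw [hΦ₂'] at hdA ⊢
        have hd3 := three_le_of_odd hodd hd1
        have h6A : 6 * A ≤ 12 := by
          rw [← hdA]
          calc 6 * A = 2 * 3 * A := by ring
            _ ≤ 2 * orderOf (ZMod.unitOfCoprime 3 copr1) * A := Nat.mul_le_mul_right _ (Nat.mul_le_mul_left 2 hd3)
        nlinarith
      · -- `b ≥ 2`: `d ≠ 3`, so `d ≥ 5`, `10A ≤ Φ₂`, `Φ₂ ≥ 156`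
        have hb2 : 2 ≤ b := by omega
        have hd3 : orderOf (ZMod.unitOfCoprime 3 copr1) ≠ 3 := fun h3 =>
          absurd (eq_thirteen_of_orderOf_eq_three hq.out hq5 hb copr1 h3).2 hb1
        have hd5 := five_le_of_odd hodd hd1 hd3
        have h10A : 10 * A ≤ (13 ^ b).totient := by
          rw [← hdA]
          calc 10 * A = 2 * 5 * A := by ring
            _ ≤ 2 * orderOf (ZMod.unitOfCoprime 3 copr1) * A := Nat.mul_le_mul_right _ (Nat.mul_le_mul_left 2 hd5)
        have h156 : 156 ≤ (13 ^ b).totient := le_trans (by norm_num) (hΦ₂ge' hb2)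
        nlinarith
  · -- `q ≥ 17` (so `q ∉ {5, 7, 13}`): `d ≥ 5` or `A = 0`; `B = 0` unless `q ≡ 1 (3)`, and then `q ≥ 19`
    have hq7 : q ≠ 7 := by omega
    have hq13 : q ≠ 13 := by omega
    have h16 : 16 ≤ (q ^ b).totient := le_trans (by omega) hΦ₂ge
    -- `10A ≤ Φ₂` in both branches of the dichotomy
    have h10A : 10 * A ≤ (q ^ b).totient := by
      rcases card_side_dichotomy hq2 hb copr1 with hA0 | ⟨hodd, hdA⟩
      · rw [← hA] at hA0
        rw [hA0, mul_zero]
        exact Nat.zero_le _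
      · rw [← hA] at hdA
        have hd1 : orderOf (ZMod.unitOfCoprime 3 copr1) ≠ 1 := by
          rw [Ne, orderOf_unitOfCoprime_eq_one_iff' copr1]
          intro h1
          have h := (ZMod.natCast_eq_natCast_iff' 3 1 (q ^ b)).1 (by rw [Nat.cast_one]; exact h1)
          have hlt : 3 < q ^ b := lt_of_lt_of_le (by omega : 3 < q) (by
            calc q = q ^ 1 := (pow_one q).symm
              _ ≤ q ^ b := Nat.pow_le_pow_right hq.out.pos (Nat.one_le_iff_ne_zero.2 hb))
          rw [Nat.mod_eq_of_lt hlt, Nat.mod_eq_of_lt (lt_trans (by norm_num) hlt)] at h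
          omega
        have hd3 : orderOf (ZMod.unitOfCoprime 3 copr1) ≠ 3 := fun h3 =>
          hq13 (eq_thirteen_of_orderOf_eq_three hq.out hq5 hb copr1 h3).1
        have hd5 := five_le_of_odd hodd hd1 hd3
        rw [← hdA]
        calc 10 * A = 2 * 5 * A := by ring
          _ ≤ 2 * orderOf (ZMod.unitOfCoprime 3 copr1) * A := Nat.mul_le_mul_right _ (Nat.mul_le_mul_left 2 hd5)
    -- `B = 0` unless `q ≡ 1 (mod 3)`, in which case `q ≥ 19` and `Φ₂ ≥ 18`
    have hq3' : q % 3 = 1 ∨ q % 3 = 2 := by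
      have h := Nat.mod_lt q (show 0 < 3 by norm_num)
      have h0 : q % 3 ≠ 0 := fun h0 => hq3 ((Nat.prime_dvd_prime_iff_eq Nat.prime_three hq.out).1 (Nat.dvd_of_mod_eq_zero h0)).symm
      omega
    rcases hq3' with h1 | h2
    · have h19 := nineteen_le_of_mod_three hq.out hq5 h1 hq7 hq13
      have h18 : 18 ≤ (q ^ b).totient := le_trans (by omega) hΦ₂ge
      by_cases ha1 : a = 1
      · subst ha1
        have ht1' : t = 1 := by rw [ht]; norm_num
        rw [ht1'] at hBt ⊢
        nlinarith
      · have ht3' := ht3 (by omega)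
        nlinarith
    · have hB0 : B = 0 := card_side_three_pow_eq_zero_of_mod_three ha copr2 h2
      rw [hB0, add_zero]
      nlinarith

end ThreeLevel

/-! ## §3 The Proposition at `N = 3ᵃqᵇ ∉ {21, 39}` and at every odd two-prime level `N ∉ {21, 39}` -/

section Proposition

/-- `ordCompl[p] (pᵃ·qᵇ) = qᵇ` for distinct primes (private copy of the sibling's). [folklore] -/
private theorem ordCompl_pow_mul_pow' {p q a b : ℕ} (hp : p.Prime) (hq : q.Prime) (hpq : p ≠ q) :
    ordCompl[p] (p ^ a * q ^ b) = q ^ b := by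
  rw [Nat.ordCompl_self_pow_mul (q ^ b) a hp, (Nat.ordCompl_eq_self_iff_zero_or_not_dvd _ hp).2]
  right
  intro h
  exact hpq ((Nat.prime_dvd_prime_iff_eq hp hq).1 (hp.dvd_of_dvd_pow h))

/-- Transport of the side count along an equality of moduli (private copy of the sibling's). [folklore] -/
private theorem card_level_congr' (r : ℕ) {M M' : ℕ} (h : M = M') :
    Nat.card {ψ : DirichletCharacter ℂ M // ψ.Odd ∧ ψ (r : ZMod M) = 1} =
      Nat.card {ψ : DirichletCharacter ℂ M' // ψ.Odd ∧ ψ (r : ZMod M') = 1} := by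
  subst h
  rfl

/-- From the two sides to the structural bound: for distinct primes `p, q`, `a, b ≥ 1` and `N = pᵃqᵇ`,
`Σ_{r ∣ N} #{ψ mod N_r odd : ψ(r) = 1} = A(p; qᵇ) + A(q; pᵃ)`, so a sides inequality is the Proposition's bound. [folklore] -/
private theorem twelve_mul_sum_card_lt_totient_of_sides {p q a b N : ℕ} [hp : Fact p.Prime] [hq : Fact q.Prime] (hpq : p ≠ q)
    (ha : a ≠ 0) (hb : b ≠ 0) (hN : N = p ^ a * q ^ b)
    (hlt : 12 * (Nat.card {ψ : DirichletCharacter ℂ (q ^ b) // ψ.Odd ∧ ψ (p : ZMod (q ^ b)) = 1} +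
        Nat.card {ψ : DirichletCharacter ℂ (p ^ a) // ψ.Odd ∧ ψ (q : ZMod (p ^ a)) = 1}) <
      (p ^ a).totient * (q ^ b).totient) :
    12 * ∑ r ∈ N.primeFactors,
        Nat.card {ψ : DirichletCharacter ℂ (ordCompl[r] N) // ψ.Odd ∧ ψ (r : ZMod (ordCompl[r] N)) = 1} < N.totient := by
  subst hN
  have hcop : (p ^ a).Coprime (q ^ b) := (((Nat.coprime_primes hp.out hq.out).2 hpq).pow_right b).pow_left a
  have hpf : (p ^ a * q ^ b).primeFactors = {p, q} := by
    rw [Nat.Coprime.primeFactors_mul hcop, Nat.primeFactors_prime_pow ha hp.out, Nat.primeFactors_prime_pow hb hq.out]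
    rfl
  have h1 : ordCompl[p] (p ^ a * q ^ b) = q ^ b := ordCompl_pow_mul_pow' hp.out hq.out hpq
  have h2 : ordCompl[q] (p ^ a * q ^ b) = p ^ a := by
    rw [mul_comm]
    exact ordCompl_pow_mul_pow' hq.out hp.out hpq.symm
  rw [hpf, Finset.sum_pair hpq, card_level_congr' p h1, card_level_congr' q h2, Nat.totient_mul hcop]
  exact hlt

/-- **THE PROPOSITION'S BOUND AT `N = 3ᵃqᵇ ∉ {21, 39}`** (`q ≥ 5` prime, `a, b ≥ 1`): twelve times the structural bound
`Σ_{r ∣ N} #{ψ mod N_r odd : ψ(r) = 1}` is `< φ(N)`. [cite: KoblitzRohrlich1978, §2 Remark 2 (p. 1193) and Proposition (p. 1190)] -/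
theorem twelve_mul_sum_card_lt_totient_three {q a b N : ℕ} [hq : Fact q.Prime] (hq5 : 5 ≤ q) (ha : a ≠ 0) (hb : b ≠ 0)
    (hN : N = 3 ^ a * q ^ b) (h21 : N ≠ 21) (h39 : N ≠ 39) :
    12 * ∑ r ∈ N.primeFactors,
        Nat.card {ψ : DirichletCharacter ℂ (ordCompl[r] N) // ψ.Odd ∧ ψ (r : ZMod (ordCompl[r] N)) = 1} < N.totient :=
  twelve_mul_sum_card_lt_totient_of_sides (p := 3) (by omega) ha hb hN
    (twelve_mul_card_sides_lt_three hq5 ha hb (hN ▸ h21) (hN ▸ h39))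

/-- **`12·#S₀(N) < φ(N)` AT `N = 3ᵃqᵇ ∉ {21, 39}`** — Koblitz–Rohrlich's Remark 2 ("If `N` is odd and `3|N` … precisely two values of `N` for which
`s(N) ≥ 1/6`: `s(21) = 1/6`, `s(39) = 1/4`") at the two-prime levels: away from `21` and `39`, `#S₀(N) < #S(N)/6`.
[cite: KoblitzRohrlich1978, §2 Remark 2 (p. 1193)] -/
theorem twelve_mul_card_bad_lt_totient_three {q a b N : ℕ} [hq : Fact q.Prime] [NeZero N] (hq5 : 5 ≤ q) (ha : a ≠ 0) (hb : b ≠ 0)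
    (hN : N = 3 ^ a * q ^ b) (h21 : N ≠ 21) (h39 : N ≠ 39) :
    12 * Nat.card {χ : DirichletCharacter ℂ N // χ.Odd ∧ bernoulliOneChar χ = 0} < N.totient :=
  lt_of_le_of_lt (Nat.mul_le_mul_left _ card_odd_bernoulliOneChar_eq_zero_le)
    (twelve_mul_sum_card_lt_totient_three hq5 ha hb hN h21 h39)

/-- **The odd-level hypothesis at `N = 3ᵃqᵇ ∉ {21, 39}`**: a finset `S₀ ⊇ {χ mod N odd : B_{1,χ} = 0}` with `12·#S₀ < φ(N)`.
[cite: KoblitzRohrlich1978, §2 Remark 2 (p. 1193)] -/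
theorem exists_goodFinset_three {q a b N : ℕ} [hq : Fact q.Prime] [NeZero N] (hq5 : 5 ≤ q) (ha : a ≠ 0) (hb : b ≠ 0)
    (hN : N = 3 ^ a * q ^ b) (h21 : N ≠ 21) (h39 : N ≠ 39) :
    ∃ S₀ : Finset (DirichletCharacter ℂ N),
      (∀ ψ : DirichletCharacter ℂ N, ψ.Odd → bernoulliOneChar ψ = 0 → ψ ∈ S₀) ∧ 12 * S₀.card < N.totient :=
  exists_goodFinset_of_sum_lt (twelve_mul_sum_card_lt_totient_three hq5 ha hb hN h21 h39)

/-- An odd prime is `3` or `≥ 5`. [folklore] -/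
private theorem three_or_five_le {p : ℕ} (hp : p.Prime) (hp2 : p ≠ 2) : p = 3 ∨ 5 ≤ p := by
  have h2 := hp.two_le
  by_cases h5 : 5 ≤ p
  · exact Or.inr h5
  · interval_cases p
    · exact absurd rfl hp2
    · exact Or.inl rfl
    · exact absurd hp (by decide)

/-- **THE PROPOSITION'S BOUND AT EVERY ODD TWO-PRIME LEVEL `N = pᵃqᵇ ∉ {21, 39}`** (`p ≠ q` odd primes, `a, b ≥ 1`): the levels prime to `6` are
the sibling's Case `m = 2`; the levels `3ᵃqᵇ` are §2. [cite: KoblitzRohrlich1978, §2 Proposition, Case 1 (pp. 1190–1191) and Remark 2 (p. 1193)] -/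
theorem twelve_mul_sum_card_lt_totient_oddTwoPrimes {p q a b N : ℕ} [hp : Fact p.Prime] [hq : Fact q.Prime] (hp2 : p ≠ 2)
    (hq2 : q ≠ 2) (hpq : p ≠ q) (ha : a ≠ 0) (hb : b ≠ 0) (hN : N = p ^ a * q ^ b) (h21 : N ≠ 21) (h39 : N ≠ 39) :
    12 * ∑ r ∈ N.primeFactors,
        Nat.card {ψ : DirichletCharacter ℂ (ordCompl[r] N) // ψ.Odd ∧ ψ (r : ZMod (ordCompl[r] N)) = 1} < N.totient := by
  rcases three_or_five_le hp.out hp2 with rfl | hp5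
  · have hq5 : 5 ≤ q := by
      rcases three_or_five_le hq.out hq2 with h | h
      · exact absurd h.symm hpq
      · exact h
    exact twelve_mul_sum_card_lt_totient_three hq5 ha hb hN h21 h39
  · rcases three_or_five_le hq.out hq2 with rfl | hq5
    · have hN' : N = 3 ^ b * p ^ a := by rw [hN, mul_comm]
      exact twelve_mul_sum_card_lt_totient_three hp5 hb ha hN' h21 h39
    · exact twelve_mul_sum_card_lt_totient hp5 hq5 hpq ha hb hN

/-- **`12·#S₀(N) < φ(N)` AT EVERY ODD TWO-PRIME LEVEL `N = pᵃqᵇ ∉ {21, 39}`.** [cite: KoblitzRohrlich1978, §2 Proposition (p. 1190) and Remark 2 (p. 1193)] -/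
theorem twelve_mul_card_bad_lt_totient_oddTwoPrimes {p q a b N : ℕ} [hp : Fact p.Prime] [hq : Fact q.Prime] [NeZero N]
    (hp2 : p ≠ 2) (hq2 : q ≠ 2) (hpq : p ≠ q) (ha : a ≠ 0) (hb : b ≠ 0) (hN : N = p ^ a * q ^ b) (h21 : N ≠ 21)
    (h39 : N ≠ 39) :
    12 * Nat.card {χ : DirichletCharacter ℂ N // χ.Odd ∧ bernoulliOneChar χ = 0} < N.totient :=
  lt_of_le_of_lt (Nat.mul_le_mul_left _ card_odd_bernoulliOneChar_eq_zero_le)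
    (twelve_mul_sum_card_lt_totient_oddTwoPrimes hp2 hq2 hpq ha hb hN h21 h39)

/-- **The odd-level hypothesis at every odd two-prime level `N ∉ {21, 39}`.** [cite: KoblitzRohrlich1978, §2 Proposition (p. 1190) and Remark 2 (p. 1193)] -/
theorem exists_goodFinset_oddTwoPrimes {p q a b N : ℕ} [hp : Fact p.Prime] [hq : Fact q.Prime] [NeZero N] (hp2 : p ≠ 2)
    (hq2 : q ≠ 2) (hpq : p ≠ q) (ha : a ≠ 0) (hb : b ≠ 0) (hN : N = p ^ a * q ^ b) (h21 : N ≠ 21) (h39 : N ≠ 39) :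
    ∃ S₀ : Finset (DirichletCharacter ℂ N),
      (∀ ψ : DirichletCharacter ℂ N, ψ.Odd → bernoulliOneChar ψ = 0 → ψ ∈ S₀) ∧ 12 * S₀.card < N.totient :=
  exists_goodFinset_of_sum_lt (twelve_mul_sum_card_lt_totient_oddTwoPrimes hp2 hq2 hpq ha hb hN h21 h39)

end Proposition

/-! ## §4 Theorems 1 (i)–(ii) and 2, relatively prime case, UNCONDITIONALLY at every odd two-prime level `N = pᵃqᵇ ∉ {21, 39}` -/

section OddTwoPrimeLevel

open CategoryTheory
open Literature.AlgebraicGeometry.Motives (AbelianVariety)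
open Literature.AlgebraicGeometry.HodgeTheory
open Literature.AlgebraicGeometry.Pohlmann1968 Literature.AlgebraicGeometry.Pohlmann1968.Cyclotomic
open CyclotomicCMTypeResidueSets (IsCMResidueSet)

variable {p q a b N : ℕ} [hp : Fact p.Prime] [hq : Fact q.Prime] [NeZero N]

/-- At an odd two-prime level `N = pᵃqᵇ`: `1 < N` and `N` is odd. [folklore] -/
private theorem level_hyps₃ (hp2 : p ≠ 2) (hq2 : q ≠ 2) (ha : a ≠ 0) (hN : N = p ^ a * q ^ b) : 1 < N ∧ Odd N := by
  subst hN
  refine ⟨?_, (hp.out.odd_of_ne_two hp2).pow.mul (hq.out.odd_of_ne_two hq2).pow⟩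
  calc 1 < p ^ a := Nat.one_lt_pow ha hp.out.one_lt
    _ ≤ p ^ a * q ^ b := Nat.le_mul_of_pos_right _ (pow_pos hq.out.pos b)

/-- **THEOREM 1 (i) at every odd two-prime level `N = pᵃqᵇ ∉ {21, 39}`, unconditionally**: for unit triples `(r,s,t)`, `(r′,s′,t′)` with
`r + s + t = 0 = r′ + s′ + t′` and a unit `h`: `H_{r′,s′,t′} = h⁻¹H_{r,s,t}` iff `{r′,s′,t′} = {hr, hs, ht}` — including the levels `3ᵃqᵇ` of
Remark 2 ("for all other values of `N` … no non-obvious isogenies … if `r, s, t, r′, s′, t′` are all prime to `N`").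
[cite: KoblitzRohrlich1978, Theorem 1 (i) (p. 1185), §2 Lemma and Proposition (pp. 1188–1191), Remark 2 (p. 1193)] -/
theorem forall_mem_fermatCMType_iff_iff_multiset_eq_oddTwoPrimes (hp2 : p ≠ 2) (hq2 : q ≠ 2) (hpq : p ≠ q) (ha : a ≠ 0)
    (hb : b ≠ 0) (hN : N = p ^ a * q ^ b) (h21 : N ≠ 21) (h39 : N ≠ 39) {r s t r' s' t' h : ZMod N}
    (hr : IsUnit r) (hs : IsUnit s) (ht : IsUnit t) (hrst : r + s + t = 0)
    (hr' : IsUnit r') (hs' : IsUnit s') (ht' : IsUnit t') (hrst' : r' + s' + t' = 0) (hh : IsUnit h) :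
    (∀ x, x ∈ fermatCMType N r' s' t' ↔ h * x ∈ fermatCMType N r s t) ↔
      ({r', s', t'} : Multiset (ZMod N)) = {h * r, h * s, h * t} := by
  obtain ⟨S₀, hS₀, hcard⟩ := exists_goodFinset_oddTwoPrimes hp2 hq2 hpq ha hb hN h21 h39
  obtain ⟨h1, h2⟩ := level_hyps₃ hp2 hq2 ha hN
  exact forall_mem_fermatCMType_iff_iff_multiset_eq_of_card h1 h2 S₀ hS₀ hcard hr hs ht hrst hr' hs' ht' hrst' hh

/-- **(∗) at every odd two-prime level `N ∉ {21, 39}`**: `H_{r′,s′,t′} = H_{r,s,t}` iff `{r′,s′,t′} = {r,s,t}` for unit triples modulo `N = pᵃqᵇ`.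
[cite: KoblitzRohrlich1978, §2 (∗) (p. 1187), Proposition (p. 1190) and Remark 2 (p. 1193)] -/
theorem fermatCMType_eq_iff_multiset_eq_oddTwoPrimes (hp2 : p ≠ 2) (hq2 : q ≠ 2) (hpq : p ≠ q) (ha : a ≠ 0) (hb : b ≠ 0)
    (hN : N = p ^ a * q ^ b) (h21 : N ≠ 21) (h39 : N ≠ 39) {r s t r' s' t' : ZMod N}
    (hr : IsUnit r) (hs : IsUnit s) (ht : IsUnit t) (hrst : r + s + t = 0)
    (hr' : IsUnit r') (hs' : IsUnit s') (ht' : IsUnit t') (hrst' : r' + s' + t' = 0) :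
    fermatCMType N r' s' t' = fermatCMType N r s t ↔ ({r', s', t'} : Multiset (ZMod N)) = {r, s, t} := by
  obtain ⟨S₀, hS₀, hcard⟩ := exists_goodFinset_oddTwoPrimes hp2 hq2 hpq ha hb hN h21 h39
  obtain ⟨h1, h2⟩ := level_hyps₃ hp2 hq2 ha hN
  exact fermatCMType_eq_iff_multiset_eq_of_card h1 h2 S₀ hS₀ hcard hr hs ht hrst hr' hs' ht' hrst'

/-- **THEOREM 2's stabiliser at every odd two-prime level `N ∉ {21, 39}`**: `wH_{1,a₀,−1−a₀} = H` iff `w = 1` or (`1 + a₀ + a₀² = 0` and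
`w ∈ {a₀, a₀²}`). [cite: KoblitzRohrlich1978, Theorem 2 (pp. 1185–1186), Proposition (p. 1190) and Remark 2 (p. 1193)] -/
theorem forall_mem_fermatCMType_one_iff_mul_mem_iff_oddTwoPrimes (hp2 : p ≠ 2) (hq2 : q ≠ 2) (hpq : p ≠ q) (ha : a ≠ 0)
    (hb : b ≠ 0) (hN : N = p ^ a * q ^ b) (h21 : N ≠ 21) (h39 : N ≠ 39) {a₀ w : ZMod N} (ha₀ : IsUnit a₀)
    (ha₁ : IsUnit (1 + a₀)) (hw : IsUnit w) :
    (∀ x, x ∈ fermatCMType N 1 a₀ (-1 - a₀) ↔ w * x ∈ fermatCMType N 1 a₀ (-1 - a₀)) ↔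
      w = 1 ∨ (1 + a₀ + a₀ ^ 2 = 0 ∧ (w = a₀ ∨ w = a₀ ^ 2)) := by
  obtain ⟨S₀, hS₀, hcard⟩ := exists_goodFinset_oddTwoPrimes hp2 hq2 hpq ha hb hN h21 h39
  obtain ⟨h1, h2⟩ := level_hyps₃ hp2 hq2 ha hN
  exact forall_mem_fermatCMType_one_iff_mul_mem_iff_of_card h1 h2 S₀ hS₀ hcard ha₀ ha₁ hw

variable {L : Type} [Field L] [NumberField L] [IsCyclotomicExtension {N} ℚ L]
  {A A' : AbelianVariety ℂ} {ι : 𝓞 L →+* End A} {θ : L →+* Module.End ℂ (complexBetti A.X 1)}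
  {ι' : 𝓞 L →+* End A'} {θ' : L →+* Module.End ℂ (complexBetti A'.X 1)}

/-- **THEOREM 2 on CM types at every odd two-prime level `N ∉ {21, 39}`**: `Φ_{(1,a₀,−1−a₀)}` of `ℚ(ζ_N)`, `N = pᵃqᵇ`, is primitive iff NOT
(`1 + a₀ + a₀² = 0` and `a₀ ≠ 1`). [cite: KoblitzRohrlich1978, Theorem 2 (pp. 1185–1186) and Remark 2 (p. 1193)] [cite: Shimura1998, §8.2 Prop. 26] -/
theorem isPrimitive_fermat_one_iff_oddTwoPrimes (hp2 : p ≠ 2) (hq2 : q ≠ 2) (hpq : p ≠ q) (ha : a ≠ 0) (hb : b ≠ 0)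
    (hN : N = p ^ a * q ^ b) (h21 : N ≠ 21) (h39 : N ≠ 39) {a₀ : ZMod N} (ha₀ : IsUnit a₀) (ha₁ : IsUnit (1 + a₀))
    {hS : ∀ c : ZMod N, c.val.Coprime N → (c ∈ fermatCMType N 1 a₀ (-1 - a₀) ↔ -c ∉ fermatCMType N 1 a₀ (-1 - a₀))}
    (φ₀ : L →+* ℂ) :
    IsPrimitive (ℂ ≃+* ℂ) (cmTypeOfResidues (L := L) (fermatCMType N 1 a₀ (-1 - a₀)) hS).1 φ₀ ↔
      ¬(1 + a₀ + a₀ ^ 2 = 0 ∧ a₀ ≠ 1) := by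
  obtain ⟨S₀, hS₀, hcard⟩ := exists_goodFinset_oddTwoPrimes hp2 hq2 hpq ha hb hN h21 h39
  obtain ⟨h1, h2⟩ := level_hyps₃ hp2 hq2 ha hN
  exact isPrimitive_fermat_one_iff_of_card h1 h2 S₀ hS₀ hcard ha₀ ha₁ φ₀

/-- **THEOREM 2 on abelian varieties at every odd two-prime level `N ∉ {21, 39}`**: an abelian variety of type `(ℚ(ζ_N); Φ_{(1,a₀,−1−a₀)})`,
`N = pᵃqᵇ`, is SIMPLE iff NOT (`1 + a₀ + a₀² = 0` and `a₀ ≠ 1`).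
[cite: KoblitzRohrlich1978, Theorem 2 (pp. 1185–1186) and Remark 2 (p. 1193)] [cite: Shimura1998, §8.2 Prop. 26] -/
theorem isSimple_of_fermat_one_iff_oddTwoPrimes (hp2 : p ≠ 2) (hq2 : q ≠ 2) (hpq : p ≠ q) (ha : a ≠ 0) (hb : b ≠ 0)
    (hN : N = p ^ a * q ^ b) (h21 : N ≠ 21) (h39 : N ≠ 39) {a₀ : ZMod N} (ha₀ : IsUnit a₀) (ha₁ : IsUnit (1 + a₀))
    {hS : ∀ c : ZMod N, c.val.Coprime N → (c ∈ fermatCMType N 1 a₀ (-1 - a₀) ↔ -c ∉ fermatCMType N 1 a₀ (-1 - a₀))}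
    (hA : IsCMTypeRealisation (cmTypeOfResidues (L := L) (fermatCMType N 1 a₀ (-1 - a₀)) hS) A ι θ) :
    A.IsSimple ↔ ¬(1 + a₀ + a₀ ^ 2 = 0 ∧ a₀ ≠ 1) := by
  obtain ⟨S₀, hS₀, hcard⟩ := exists_goodFinset_oddTwoPrimes hp2 hq2 hpq ha hb hN h21 h39
  obtain ⟨h1, h2⟩ := level_hyps₃ hp2 hq2 ha hN
  exact isSimple_of_fermat_one_iff_of_card h1 h2 S₀ hS₀ hcard ha₀ ha₁ hA

/-- **THEOREM 1 (ii) at every odd two-prime level `N ∉ {21, 39}`** ("no non-obvious isogenies between `J_{r,s,t}` and `J_{r′,s′,t′}` if `r, s, t,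
r′, s′, t′` are all prime to `N`"): for unit triples modulo `N = pᵃqᵇ`, abelian varieties of types `Φ_{H_{r,s,t}}`, `Φ_{H_{r′,s′,t′}}` are isogenous
iff `{r′,s′,t′} = u·{r,s,t}` for a unit `u`.
[cite: KoblitzRohrlich1978, Theorem 1 (ii) (p. 1185) and Remark 2 (p. 1193)] [cite: Shimura1998, §8.4 Example (1) and §6.1 Corollary] -/
theorem isIsogenous_fermatCMType_iff_exists_multiset_eq_oddTwoPrimes [IsCMField L] (hp2 : p ≠ 2) (hq2 : q ≠ 2) (hpq : p ≠ q)
    (ha : a ≠ 0) (hb : b ≠ 0) (hN : N = p ^ a * q ^ b) (h21 : N ≠ 21) (h39 : N ≠ 39) {r s t r' s' t' : ZMod N}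
    (hr : IsUnit r) (hs : IsUnit s) (ht : IsUnit t) (hrst : r + s + t = 0)
    (hr' : IsUnit r') (hs' : IsUnit s') (ht' : IsUnit t') (hrst' : r' + s' + t' = 0)
    (hS : IsCMResidueSet N (fermatCMType N r s t)) (hS' : IsCMResidueSet N (fermatCMType N r' s' t'))
    (hA : IsCMTypeRealisation (cmTypeOfResidues (L := L) (fermatCMType N r s t) hS.cm) A ι θ)
    (hA' : IsCMTypeRealisation (cmTypeOfResidues (L := L) (fermatCMType N r' s' t') hS'.cm) A' ι' θ') :
    AbelianVariety.IsIsogenous A A' ↔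
      ∃ u : ZMod N, IsUnit u ∧ ({r', s', t'} : Multiset (ZMod N)) = {u * r, u * s, u * t} := by
  obtain ⟨S₀, hS₀, hcard⟩ := exists_goodFinset_oddTwoPrimes hp2 hq2 hpq ha hb hN h21 h39
  obtain ⟨h1, h2⟩ := level_hyps₃ hp2 hq2 ha hN
  exact isIsogenous_fermatCMType_iff_exists_multiset_eq_of_card h1 h2 S₀ hS₀ hcard hr hs ht hrst hr' hs' ht' hrst' hS hS'
    hA hA'

/-- **Non-vacuity at every odd two-prime level `N ∉ {21, 39}`**: for units `a₀`, `1 + a₀` with NOT (`1 + a₀ + a₀² = 0 ∧ a₀ ≠ 1`) there is a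
SIMPLE abelian variety of dimension `φ(N)/2` of type `Φ_{(1,a₀,−1−a₀)}`. [cite: Shimura1998, §6.2 Thm. 3] [cite: KoblitzRohrlich1978, Theorem 2 and Remark 2] -/
theorem exists_isSimple_of_fermat_one_oddTwoPrimes (hp2 : p ≠ 2) (hq2 : q ≠ 2) (hpq : p ≠ q) (ha : a ≠ 0) (hb : b ≠ 0)
    (hN : N = p ^ a * q ^ b) (h21 : N ≠ 21) (h39 : N ≠ 39) {a₀ : ZMod N} (ha₀ : IsUnit a₀) (ha₁ : IsUnit (1 + a₀))
    (H : ¬(1 + a₀ + a₀ ^ 2 = 0 ∧ a₀ ≠ 1))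
    (hS : ∀ c : ZMod N, c.val.Coprime N → (c ∈ fermatCMType N 1 a₀ (-1 - a₀) ↔ -c ∉ fermatCMType N 1 a₀ (-1 - a₀))) :
    ∃ (B : AbelianVariety ℂ) (ι' : 𝓞 L →+* End B) (θ' : L →+* Module.End ℂ (complexBetti B.X 1)),
      IsCMTypeRealisation (cmTypeOfResidues (L := L) (fermatCMType N 1 a₀ (-1 - a₀)) hS) B ι' θ' ∧
        B.IsSimple ∧ B.dim = N.totient / 2 := by
  obtain ⟨S₀, hS₀, hcard⟩ := exists_goodFinset_oddTwoPrimes hp2 hq2 hpq ha hb hN h21 h39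
  obtain ⟨h1, h2⟩ := level_hyps₃ hp2 hq2 ha hN
  exact exists_isSimple_of_fermat_one_of_card h1 h2 S₀ hS₀ hcard ha₀ ha₁ H hS

end OddTwoPrimeLevel

end CyclotomicFermatCMType

end Literature.AlgebraicGeometry.ComplexMultiplication
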